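import Literature.Probability.Percolation.SlabCircuitSideVsHub
import HarnessLib

/-!
# Newman–Tassion–Wu 2017, Theorem 3.10 — the side crossings of the ring have probability bounded
# below in terms of `f_p(2n, n-1)` and `λ` only (Prop. 3.9 (1) iterated)

Topic: `Literature/Probability/Percolation`. Twelfth file of the port of THEOREM 3.10 of
Newman–Tassion–Wu, *Critical percolation and the minimal spanning tree in slabs* (CPAM 70 (2017);
arXiv:1512.09107, p. 13): "as in the proof of Proposition 3.9, we can use the estimate (3.70)
[`f(2n,n-1) ≥ c`] to show that `P[B(S₁) ⟷^{S₁} R(S₁)] ≥ h(c)` for some `h ∈ 𝓗` (that depends on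
`λ`).  Therefore, there exists a constant `c₂ = c₂(c,λ) > 0` such that `P[ℰ] ≥ c₂`."  For the side
crossings `sideCross*` of the port's ring (`SlabCircuitSideCrossings.lean`; long boxes of
`2N+2n+2` columns and `n` rows) this follows from p2's iterated Prop. 3.9 (1) (`prop39_item1`):

* `posIter K c j` — the iteration `g₀ = c`, `g_{j+1} = ((1 - √(1-g_j)) g_j)² / K`; `posIter_pos`.
* `real_lr_ge_posIter` — `P[L ⟷ R in [0, n-1+(j+1)(n+1)] × [0,n-1]] ≥ posIter K c j` when
  `c ≤ f_p(2n,n-1)` (`n ≥ 52`).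
* **`real_sideCross_ge_posIter`** — for `n ≥ 52`, `n ≤ N` and `2N+2n+1 ≤ n-1+(j+1)(n+1)`:
  `posIter K c j ≤ P[sideCross_X k N n]` for the four sides (translation / transposition).

## Sources

* C. M. Newman, V. Tassion, W. Wu, *Critical percolation and the minimal spanning tree in slabs*,
  Comm. Pure Appl. Math. 70 (2017) 2084–2120, arXiv:1512.09107: proof of Theorem 3.10, (3.73)–(3.74),
  and Proposition 3.9 (1) [NewmanTassionWu2017].
-/

noncomputable section

namespace Literature.Probability.Percolation

open MeasureTheory LatticeModels
open scoped LatticeModels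

namespace NTW17

variable {k : ℕ}

/-! ## The iteration -/

/-- The Prop. 3.9 (1) iteration: `g₀ = c`, `g_{j+1} = ((1 - √(1 - g_j)) · g_j)² / K`.
[cite: NewmanTassionWu2017, §3.3 (Proposition 3.9 (1), h₂^{j-1})] -/
def posIter (K c : ℝ) : ℕ → ℝ
  | 0 => c
  | j + 1 => ((1 - Real.sqrt (1 - posIter K c j)) * posIter K c j) ^ 2 / K

/-- The iteration stays in `(0, 1]`. [cite: NewmanTassionWu2017, §3.3 (Proposition 3.9 (1))] -/
theorem posIter_pos_le {K c : ℝ} (hK : 1 ≤ K) (hc0 : 0 < c) (hc1 : c ≤ 1) :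
    ∀ j, 0 < posIter K c j ∧ posIter K c j ≤ 1 := by
  intro j
  induction j with
  | zero => exact ⟨hc0, hc1⟩
  | succ j ih =>
    obtain ⟨h0, h1⟩ := ih
    have hK0 : 0 < K := by linarith
    have hs : Real.sqrt (1 - posIter K c j) < 1 := by
      rw [Real.sqrt_lt' one_pos]; linarith
    have hs0 : 0 ≤ Real.sqrt (1 - posIter K c j) := Real.sqrt_nonneg _
    have hg : 0 < 1 - Real.sqrt (1 - posIter K c j) := by linarith
    refine ⟨?_, ?_⟩
    · simp only [posIter]
      exact div_pos (by positivity) hK0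
    · simp only [posIter]
      rw [div_le_one hK0]
      have h2 : (1 - Real.sqrt (1 - posIter K c j)) * posIter K c j ≤ 1 := by
        calc (1 - Real.sqrt (1 - posIter K c j)) * posIter K c j ≤ 1 * 1 := by
              apply mul_le_mul <;> linarith
          _ = 1 := by ring
      have h3 : 0 ≤ (1 - Real.sqrt (1 - posIter K c j)) * posIter K c j := by positivity
      calc ((1 - Real.sqrt (1 - posIter K c j)) * posIter K c j) ^ 2 ≤ 1 ^ 2 := by gcongr
        _ = 1 := by ring
        _ ≤ K := hK

/-- The map `x ↦ ((1 - √(1-x)) x)²` is monotone on `[0, 1]`. [cite: NewmanTassionWu2017, §3.3 (Proposition 3.9, 𝓗: increasing functions)] -/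
theorem sq_step_mono {x y : ℝ} (hx0 : 0 ≤ x) (hxy : x ≤ y) :
    ((1 - Real.sqrt (1 - x)) * x) ^ 2 ≤ ((1 - Real.sqrt (1 - y)) * y) ^ 2 := by
  have h1 : 1 - Real.sqrt (1 - x) ≤ 1 - Real.sqrt (1 - y) := by gcongr
  have h0 : 0 ≤ 1 - Real.sqrt (1 - x) := by rw [sub_nonneg, Real.sqrt_le_one]; linarith
  have : (1 - Real.sqrt (1 - x)) * x ≤ (1 - Real.sqrt (1 - y)) * y :=
    mul_le_mul h1 hxy hx0 (h0.trans h1)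
  have h2 : 0 ≤ (1 - Real.sqrt (1 - x)) * x := mul_nonneg h0 hx0
  gcongr

/-! ## Long boxes -/

/-- **`F_{j+1} ≥ g_j`**: for `n ≥ 52`, `0 < p < 1` and `0 < c ≤ f_p(2n, n-1)`, the box
`[0, n-1+(j+1)(n+1)] × [0, n-1]` (rows `n`) is crossed from left to right with probability at least
`posIter (K₁²K₂) c j`. [cite: NewmanTassionWu2017, Theorem 3.10 (proof, "P[B(S₁) ⟷^{S₁} R(S₁)] ≥ h(c)") and Proposition 3.9 (1)] -/
theorem real_lr_ge_posIter (hk : 1 ≤ k) {n : ℕ} (hn : 52 ≤ n) (p : unitInterval) (hp0 : 0 < (p : ℝ))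
    (hp1 : (p : ℝ) < 1) {c : ℝ} (hc0 : 0 < c) (hc : c ≤ crossingProb k p (2 * n) (n - 1)) :
    ∀ j : ℕ, posIter (glueK k p) c j ≤ (bondPercolation (slabGraph 3 k) p).real
      (slabConn k (boxR 0 (((n : ℤ) - 1) + ((j : ℤ) + 1) * ((n : ℤ) + 1)) 0 ((n : ℤ) - 1)) {z | z.1 = 0}
        {z | z.1 = ((n : ℤ) - 1) + ((j : ℤ) + 1) * ((n : ℤ) + 1)}) := by
  set P := bondPercolation (slabGraph 3 k) p with hP
  set n' : ℤ := (n : ℤ) - 1 with hn'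
  set h : ℤ := n' / 2 with hh
  have hh2 : 2 ≤ h := by omega
  have hhn : 2 * h ≤ n' := by omega
  have hhn' : n' ≤ 2 * h + 1 := by omega
  have hK1 : 1 ≤ glueK k p := by
    have hb : 0 ≤ 2 / min (p : ℝ) (1 - p) :=
      div_nonneg (by norm_num) (le_min p.2.1 (sub_nonneg.2 p.2.2))
    have h1 : 1 ≤ 1 + (2 / min (p : ℝ) (1 - p)) ^ (3 * ((5 * k + 4) * (2 * (6 * 4 + 4) + 1) ^ 2)) :=
      le_add_of_nonneg_right (pow_nonneg hb _)
    have h2 : 1 ≤ 1 + (2 / min (p : ℝ) (1 - p)) ^ (3 * ((5 * k + 4) * (2 * (2 * (3 * 4 + 3)) + 1) ^ 2)) :=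
      le_add_of_nonneg_right (pow_nonneg hb _)
    unfold glueK
    exact one_le_mul_of_one_le_of_one_le (one_le_pow₀ h1) h2
  have hc1 : c ≤ 1 := hc.trans (by rw [crossingProb_eq]; exact measureReal_le_one)
  intro j
  induction j with
  | zero =>
    -- `F_1 = f(2n, n-1) ≥ c`
    simp only [posIter, Nat.cast_zero, zero_add, one_mul]
    rw [crossingProb_eq] at hc
    have e1 : ((2 * n : ℕ) : ℤ) = n' + (n' + 1) + 1 := by rw [hn']; push_cast; ring
    have e2 : ((n - 1 : ℕ) : ℤ) = n' := by rw [hn']; omega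
    rw [e1, e2] at hc
    have e3 : n' + ((n : ℤ) + 1) = n' + (n' + 1) + 1 := by rw [hn']; ring
    rw [e3]
    exact hc
  | succ j ih =>
    have hstep := prop39_item1 (k := k) hk (ρ := 4) le_rfl (n := n') (m := (n : ℤ) + 1) (h := h) (j := j + 1)
      (by omega) hh2 hhn hhn' (by positivity) (by push_cast; nlinarith) p hp0 hp1
    set F := P.real (slabConn k (boxR 0 (n' + ((j + 1 : ℕ) : ℤ) * ((n : ℤ) + 1)) 0 n') {z | z.1 = 0}
      {z | z.1 = n' + ((j + 1 : ℕ) : ℤ) * ((n : ℤ) + 1)}) with hF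
    set F' := P.real (slabConn k (boxR 0 (n' + (((j + 1 : ℕ) : ℤ) + 1) * ((n : ℤ) + 1)) 0 n') {z | z.1 = 0}
      {z | z.1 = n' + (((j + 1 : ℕ) : ℤ) + 1) * ((n : ℤ) + 1)}) with hF'
    have ih' : posIter (glueK k p) c j ≤ F := by
      have e : ((j : ℤ) + 1) = ((j + 1 : ℕ) : ℤ) := by push_cast; ring
      rw [hF, ← e]; exact ih
    obtain ⟨hg0, -⟩ := posIter_pos_le hK1 hc0 hc1 j
    have hmono := sq_step_mono hg0.le ih'
    have hK0 : 0 < glueK k p := glueK_pos k p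
    have hstep' : ((1 - Real.sqrt (1 - F)) * F) ^ 2 ≤ glueK k p * F' := hstep
    simp only [posIter]
    rw [div_le_iff₀ hK0]
    calc ((1 - Real.sqrt (1 - posIter (glueK k p) c j)) * posIter (glueK k p) c j) ^ 2
        ≤ ((1 - Real.sqrt (1 - F)) * F) ^ 2 := hmono
      _ ≤ glueK k p * F' := hstep'
      _ = F' * glueK k p := mul_comm _ _

/-! ## The four side crossings -/

section Sides

variable {N n : ℕ}

/-- A long box crossed at least as easily as a longer one, in place (translation + width
monotonicity). [cite: NewmanTassionWu2017, §3.3 ((3.8), "invariance under translation")] -/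
theorem real_lr_ge_of_longer {a b b' r : ℤ} {n : ℕ} (hab : a ≤ b) (hbb : b ≤ b') (p : unitInterval) :
    (bondPercolation (slabGraph 3 k) p).real
        (slabConn k (boxR 0 (b' - a) 0 ((n : ℤ) - 1)) {z | z.1 = 0} {z | z.1 = b' - a}) ≤
      (bondPercolation (slabGraph 3 k) p).real
        (slabConn k (boxR a b r (r + n - 1)) {z | z.1 = a} {z | z.1 = b}) := by
  have h1 := real_lr_wider_le (k := k) (a := a) (b := b) (b' := b') (c := r) (d := r + n - 1) hab hbb p
  have h2 := real_lr_shift (k := k) (a, r) 0 (b' - a) 0 ((n : ℤ) - 1) p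
  simp only at h2
  rw [show (0 : ℤ) + a = a by ring, show b' - a + a = b' by ring, show (0 : ℤ) + r = r by ring,
    show (n : ℤ) - 1 + r = r + n - 1 by ring] at h2
  rw [← h2]; exact h1

/-- **Positivity of the side crossings** (NTW (3.73)–(3.74)): for `n ≥ 52`, `n ≤ N`, `0 < p < 1`,
`0 < c ≤ f_p(2n, n-1)` and any `j` with `2N + 2n + 1 ≤ n - 1 + (j+1)(n+1)`:
`posIter (K₁²K₂) c j ≤ P[sideCross_X k N n]` for the four sides. [cite: NewmanTassionWu2017, Theorem 3.10 (proof, (3.73)–(3.74))] -/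
theorem real_sideCross_ge_posIter (hk : 1 ≤ k) (hn : 52 ≤ n) (hNn : n ≤ N) (p : unitInterval)
    (hp0 : 0 < (p : ℝ)) (hp1 : (p : ℝ) < 1) {c : ℝ} (hc0 : 0 < c) (hc : c ≤ crossingProb k p (2 * n) (n - 1))
    {j : ℕ} (hj : 2 * (N : ℤ) + 2 * n + 1 ≤ ((n : ℤ) - 1) + ((j : ℤ) + 1) * ((n : ℤ) + 1)) :
    posIter (glueK k p) c j ≤ (bondPercolation (slabGraph 3 k) p).real (sideCrossT k N n) ∧
      posIter (glueK k p) c j ≤ (bondPercolation (slabGraph 3 k) p).real (sideCrossR k N n) ∧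
      posIter (glueK k p) c j ≤ (bondPercolation (slabGraph 3 k) p).real (sideCrossB k N n) ∧
      posIter (glueK k p) c j ≤ (bondPercolation (slabGraph 3 k) p).real (sideCrossL k N n) := by
  have hlong := real_lr_ge_posIter (k := k) hk hn p hp0 hp1 hc0 hc j
  -- a box of `2N+2n+2` columns placed anywhere is crossed at least as easily as the longer standard one
  have key : ∀ a r : ℤ, posIter (glueK k p) c j ≤ (bondPercolation (slabGraph 3 k) p).real
      (slabConn k (boxR a (a + (2 * (N : ℤ) + 2 * n + 1)) r (r + n - 1)) {z | z.1 = a}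
        {z | z.1 = a + (2 * (N : ℤ) + 2 * n + 1)}) := by
    intro a r
    refine hlong.trans ?_
    have h := real_lr_ge_of_longer (k := k) (n := n) (a := a) (b := a + (2 * (N : ℤ) + 2 * n + 1))
      (b' := a + (((n : ℤ) - 1) + ((j : ℤ) + 1) * ((n : ℤ) + 1))) (r := r) (by omega) (by omega) p
    rw [show a + ((n : ℤ) - 1 + ((j : ℤ) + 1) * ((n : ℤ) + 1)) - a = (n : ℤ) - 1 + ((j : ℤ) + 1) * ((n : ℤ) + 1)
      by ring] at h
    exact h
  refine ⟨?_, ?_, ?_, ?_⟩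
  · have h := key (-((N : ℤ) + n)) ((N : ℤ) + 1)
    rw [show -((N : ℤ) + n) + (2 * (N : ℤ) + 2 * n + 1) = (N : ℤ) + n + 1 by ring,
      show (N : ℤ) + 1 + n - 1 = (N : ℤ) + n by ring] at h
    exact h
  · have h := key (-((N : ℤ) + n + 1)) ((N : ℤ) + 1)
    rw [show -((N : ℤ) + n + 1) + (2 * (N : ℤ) + 2 * n + 1) = (N : ℤ) + n by ring,
      show (N : ℤ) + 1 + n - 1 = (N : ℤ) + n by ring] at h
    have ec : sideCrossR k N n = slabConn k (ringSideR N n) {z | z.2 = -((N : ℤ) + n + 1)} {z | z.2 = (N : ℤ) + n} :=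
      Set.ext fun ω => ⟨fun h => slabConn_comm h, fun h => slabConn_comm h⟩
    rw [ec, ringSideR, real_bt_eq_lr]
    exact h
  · have h := key (-((N : ℤ) + n + 1)) (-((N : ℤ) + n))
    rw [show -((N : ℤ) + n + 1) + (2 * (N : ℤ) + 2 * n + 1) = (N : ℤ) + n by ring,
      show -((N : ℤ) + n) + n - 1 = -((N : ℤ) + 1) by ring] at h
    have ec : sideCrossB k N n = slabConn k (ringSideB N n) {z | z.1 = -((N : ℤ) + n + 1)} {z | z.1 = (N : ℤ) + n} :=
      Set.ext fun ω => ⟨fun h => slabConn_comm h, fun h => slabConn_comm h⟩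
    rw [ec, ringSideB]
    exact h
  · have h := key (-((N : ℤ) + n)) (-((N : ℤ) + n))
    rw [show -((N : ℤ) + n) + (2 * (N : ℤ) + 2 * n + 1) = (N : ℤ) + n + 1 by ring,
      show -((N : ℤ) + n) + n - 1 = -((N : ℤ) + 1) by ring] at h
    rw [sideCrossL, ringSideL, real_bt_eq_lr]
    exact h

end Sides

end NTW17

end Literature.Probability.Percolation

end
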